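import Summits.CriticalPhenomena.Ising3D.IsingColumnFaceL11CensusRadiiCoreTrg

/-!
# The catalogue census of §7.3 as kernel facts, VIII-C: kernel evaluations for the `TRG` radius —
window `2` of the covering check and parts `4`, `5` of the hole-window check (cell `pub-ising3x`, seat
recog-1; paper §1.6 / §7.3)

HONEST FRAMING: lottery ticket; floor = tightest certified 3D Ising CFT bounds; no exact-solution claim without a proof. Island framing: certified exclusion region at stated derivative order and
assumptions; not a determination of the 3D Ising critical exponents beyond that.

Three `decide +kernel` evaluations of the machine of `IsingColumnFaceL11CensusRadiiCore{,Trg}.lean`: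
* `trgCover_p2` — window `2` of `4` of the certified segment in units `trgU = 10¹⁵·lcm(1..32)`: the kernel
  enumerates the `TRG` candidates of the window (`trgWin`; 15583 of them, by the Python twin), sorts their
  certified enclosures (`msortN`) and checks the chain with gap constant `trgG` (`zgapsLE`);
* `trgHole_part4`, `trgHole_part5` — parts `4`, `5` (`trgFullPart`, `ExclusionSentencesTrgGamma`: two
  `Γ`-classes each) of the landed exhaustive full-`TRG` checker on the hole window `[trgHoleA, trgHoleB]` listing
  the two bounding tuples `trgHoleX`, `trgHoleY`.
Assembled in `…CensusRadiiTrg.lean`. Heartbeat / recursion options as in the cell's certificate files. Pure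
arithmetic; no certificate, no datum, no σ–ε axiom; nothing is recognised.
lottery ticket; floor = tightest certified 3D Ising CFT bounds; no exact-solution claim without a proof.
-/

namespace Summit.CriticalPhenomena.Ising3D
namespace ColumnFaceL11
open Set Literature.MathematicalPhysics.QuantumFieldTheory.ConformalBootstrap3D

set_option maxHeartbeats 200000000 in
set_option maxRecDepth 200000 in
/-- `TRG` window `2`: start `192032752102402148437499999999`, end `196668754838121972656249999999 + trgG` (units `trgU`): every
candidate enclosure's upper end is within `trgG` of the running reference point, up to the end. [folklore] -/
theorem trgCover_p2 : trgCover trgG 192032752102402148437499999999 (196668754838121972656249999999 + trgG) = true := by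
  decide +kernel

set_option maxHeartbeats 200000000 in
set_option maxRecDepth 200000 in
/-- Part `4` of the landed full-`TRG` checker on the hole window lists only `trgHoleX`, `trgHoleY` (up to
non-reduced fractions). [folklore] -/
theorem trgHole_part4 : trgFullPart 17 32 4 trgHoleA trgHoleB [trgHoleX, trgHoleY] = true := by
  decide +kernel

set_option maxHeartbeats 200000000 in
set_option maxRecDepth 200000 in
/-- Part `5` of the landed full-`TRG` checker on the hole window lists only `trgHoleX`, `trgHoleY` (up to
non-reduced fractions). [folklore] -/
theorem trgHole_part5 : trgFullPart 17 32 5 trgHoleA trgHoleB [trgHoleX, trgHoleY] = true := by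
  decide +kernel

end ColumnFaceL11
end Summit.CriticalPhenomena.Ising3D
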